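import Summits.QuantumAdvantage.QuantumAdvantage.Theorems.CubicForrelationSignedExactCubicForrelationNotPrBPPStubPolarGeometry

/-!
# Item `CubicForrelation.SignedExactCubicForrelationInPrBPP` (stmt-QuantumAdvantage-14671): the THREE-MATCHING identity

Support lemma (seat c3, 2026-08-16) for the refutation-direction item stmt-QuantumAdvantage-14671 (= `¬` crux r3
`SignedExactCubicForrelationNotPrBPP`, stmt-QuantumAdvantage-13932), whose open core is a worst-case M-subspace finder
for exact cubic pairs `g(y',y'') = y'·π(y'') ⊕ h(y'')`, `π` a quadratic bijection of `𝔽₂^m` with QUADRATIC inverse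
`σ` ("biquadratic"; `stub_dualShape`). This file proves a new exact identity satisfied by every such pair `(π, σ)`.

Write `B(a,b) := π(x) ⊕ π(x⊕a) ⊕ π(x⊕b) ⊕ π(x⊕a⊕b)` for the (base-point free) bracket = polar vector of `π`
(`PolarGeometry.quad_bracket`: for coordinatewise-quadratic `π` the bracket does not depend on `x`) and `B̃` for the
bracket of `σ`. Then for all `s t u v`:

  `B̃(B(s,t), B(u,v)) = B̃(B(s,u), B(t,v)) ⊕ B̃(B(t,u), B(s,v))`     (`threeMatching_of_brackets`, `threeMatching`)

i.e. the sum of `B̃(B(·,·),B(·,·))` over the three perfect matchings of `{s,t,u,v}` vanishes. Informally it is the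
vanishing of the degree-`4` part of the Boolean polynomial `σ ∘ π = id`; the proof here is purely by finite differences:
(1) from `σ(π z) = z` at `z, z⊕u, z⊕v, z⊕u⊕v` and the two bracket identities one gets, for every `z`,
`B̃(π(z⊕u⊕v), B(u,v)) = σ(0) ⊕ σ(B(u,v)) ⊕ B̃(π z ⊕ π(z⊕u), π z ⊕ π(z⊕v))` (`key_identity`);
(2) a second difference of (1) in `z` along `s, t`, using biadditivity of `B`, `B̃` (derived from base-point freeness)
and the expansion of a biadditive map on a `2 × 2` grid of affine arguments (`second_diff`), gives the identity.
Only `σ ∘ π = id` is used (not `π ∘ σ = id`). The hypotheses are stated for ABSTRACT brackets `B`, `B̃` (functions with the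
base-point-free bracket property), then specialised to coordinatewise `IsDegLeFun 2` maps via `PolarGeometry.quad_bracket`.
Use: a polynomial necessary condition on the pair of differential tensors of an exact cubic pair (it forces the composite
`T_f(T_g(y₁,y₂,·),T_g(y₃,y₄,·),·)` summed over the three matchings to lie in the hidden M-subspace), recorded for the finder
analysis of line `dual-pingpong-frame`; no definitions are introduced.
References: C. Carlet, *Boolean Functions for Cryptography and Coding Theory*, CUP 2020, §2.2.2 (derivatives, degree),
§5.2 (polar forms) [Carlet2020]; R. O'Donnell, *Analysis of Boolean Functions*, CUP 2014, §3.3 [ODonnell2014].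
-/

noncomputable section

set_option linter.dupNamespace false -- D-0017: single-problem summit ⇒ `QuantumAdvantage.QuantumAdvantage` by design

namespace Summit.QuantumAdvantage.QuantumAdvantage.Theorems.SignedExactCubicForrelationInPrBPP

open Finset
open Literature.Computability.Complexity Literature.Computability.QuantumComplexity
open Literature.Computability.QuantumComplexity.BuzetChailloux (bxor zeroVec bxor_self bxor_comm bxor_zeroVec
  zeroVec_bxor bxor_bxor_cancel_left)

namespace ThreeMatching

variable {m : ℕ}

/-! ### Bit-vector bookkeeping -/

/-- `(x ⊕ y) ⊕ z = (x ⊕ z) ⊕ y`. [folklore] -/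
theorem bxor_right_comm (x y z : Fin m → Bool) : bxor (bxor x y) z = bxor (bxor x z) y := by
  funext i
  show ((x i ^^ y i) ^^ z i) = ((x i ^^ z i) ^^ y i)
  cases x i <;> cases y i <;> cases z i <;> rfl

/-- Pointwise form of a bit-vector equation. [folklore] -/
theorem apply_eq_of_eq {x y : Fin m → Bool} (h : x = y) (i : Fin m) : x i = y i := congrFun h i

/-! ### Consequences of a base-point-free bracket -/

section bracket

variable {φ : (Fin m → Bool) → Fin m → Bool} {F : (Fin m → Bool) → (Fin m → Bool) → Fin m → Bool}

/-- Four-variable Boolean rearrangement behind symmetry of the bracket. [folklore] -/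
theorem bool_sym (a b c d : Bool) : ((a ^^ b) ^^ (c ^^ d)) = ((a ^^ c) ^^ (b ^^ d)) := by
  cases a <;> cases b <;> cases c <;> cases d <;> rfl

/-- **Symmetry** of a base-point-free bracket: `F a b = F b a`. [cite: Carlet2020, §5.2] -/
theorem bracket_symm
    (hF : ∀ x a b, bxor (bxor (φ x) (φ (bxor x a))) (bxor (φ (bxor x b)) (φ (bxor (bxor x a) b))) = F a b)
    (a b : Fin m → Bool) : F a b = F b a := by
  rw [← hF zeroVec a b, ← hF zeroVec b a, bxor_right_comm (zeroVec : Fin m → Bool) a b]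
  funext i
  exact bool_sym _ _ _ _

/-- Six-variable Boolean rearrangement behind additivity of the bracket. [folklore] -/
theorem bool_add (p q r s t w : Bool) :
    (((p ^^ q) ^^ (r ^^ s)) ^^ ((r ^^ s) ^^ (t ^^ w))) = ((p ^^ q) ^^ (t ^^ w)) := by
  cases p <;> cases q <;> cases r <;> cases s <;> cases t <;> cases w <;> rfl

/-- **Additivity in the second slot** of a base-point-free bracket: `F a (b ⊕ c) = F a b ⊕ F a c` (the brackets at
base points `0` and `0 ⊕ b` telescope). [cite: Carlet2020, §5.2] -/
theorem bracket_add_right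
    (hF : ∀ x a b, bxor (bxor (φ x) (φ (bxor x a))) (bxor (φ (bxor x b)) (φ (bxor (bxor x a) b))) = F a b)
    (a b c : Fin m → Bool) : F a (bxor b c) = bxor (F a b) (F a c) := by
  have h1 := hF zeroVec a b
  have h2 := hF (bxor zeroVec b) a c
  have h3 := hF zeroVec a (bxor b c)
  rw [← h1, ← h2, ← h3]
  have e1 : bxor (bxor (zeroVec : Fin m → Bool) b) a = bxor (bxor zeroVec a) b := bxor_right_comm _ _ _
  have e2 : bxor (bxor (zeroVec : Fin m → Bool) a) (bxor b c) = bxor (bxor (bxor zeroVec a) b) c := by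
    funext i; exact (Bool.xor_assoc _ _ _).symm
  have e3 : bxor (bxor (zeroVec : Fin m → Bool) b) c = bxor zeroVec (bxor b c) := by
    funext i; exact Bool.xor_assoc _ _ _
  rw [e1, e2, e3]
  funext i
  exact (bool_add _ _ _ _ _ _).symm

/-- **Additivity in the first slot** (from symmetry and additivity in the second slot). [cite: Carlet2020, §5.2] -/
theorem bracket_add_left
    (hF : ∀ x a b, bxor (bxor (φ x) (φ (bxor x a))) (bxor (φ (bxor x b)) (φ (bxor (bxor x a) b))) = F a b)
    (a b c : Fin m → Bool) : F (bxor a b) c = bxor (F a c) (F b c) := by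
  rw [bracket_symm hF (bxor a b) c, bracket_add_right hF c a b, bracket_symm hF c a, bracket_symm hF c b]

/-- **Value expansion**: `φ(x ⊕ a) = φ(0) ⊕ φ(x) ⊕ φ(a) ⊕ F x a` (the bracket at base point `0`). [cite: Carlet2020, §5.2] -/
theorem bracket_expand
    (hF : ∀ x a b, bxor (bxor (φ x) (φ (bxor x a))) (bxor (φ (bxor x b)) (φ (bxor (bxor x a) b))) = F a b)
    (x a : Fin m → Bool) :
    φ (bxor x a) = bxor (bxor (φ zeroVec) (φ x)) (bxor (φ a) (F x a)) := by
  have h := hF zeroVec x a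
  rw [zeroVec_bxor, zeroVec_bxor] at h
  rw [← h]
  funext i
  show φ (bxor x a) i =
    ((φ zeroVec i ^^ φ x i) ^^ (φ a i ^^ ((φ zeroVec i ^^ φ x i) ^^ (φ a i ^^ φ (bxor x a) i))))
  cases φ zeroVec i <;> cases φ x i <;> cases φ a i <;> cases φ (bxor x a) i <;> rfl

/-- The bracket at `0` in the first slot vanishes: `F 0 a = 0`. [folklore] -/
theorem bracket_zero_left
    (hF : ∀ x a b, bxor (bxor (φ x) (φ (bxor x a))) (bxor (φ (bxor x b)) (φ (bxor (bxor x a) b))) = F a b)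
    (a : Fin m → Bool) : F zeroVec a = zeroVec := by
  have h := bracket_add_left hF zeroVec zeroVec a
  rw [zeroVec_bxor] at h
  funext i
  have hi := apply_eq_of_eq h i
  revert hi
  show F zeroVec a i = (F zeroVec a i ^^ F zeroVec a i) → F zeroVec a i = false
  cases F zeroVec a i <;> simp

end bracket

/-! ### A biadditive map on a `2 × 2` grid of affine arguments -/

/-- **Second difference of a biadditive map along a `2 × 2` grid**: for `F` additive in both slots,
`F(A,C) ⊕ F(A⊕p, C⊕q) ⊕ F(A⊕r, C⊕w) ⊕ F(A⊕p⊕r, C⊕q⊕w) = F(p,w) ⊕ F(r,q)` (only the cross terms survive).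
[folklore] -/
theorem second_diff (F : (Fin m → Bool) → (Fin m → Bool) → Fin m → Bool)
    (add1 : ∀ a b c, F (bxor a b) c = bxor (F a c) (F b c))
    (add2 : ∀ a b c, F a (bxor b c) = bxor (F a b) (F a c))
    (A C p q r w : Fin m → Bool) :
    bxor (bxor (F A C) (F (bxor A p) (bxor C q)))
        (bxor (F (bxor A r) (bxor C w)) (F (bxor (bxor A p) r) (bxor (bxor C q) w))) =
      bxor (F p w) (F r q) := by
  simp only [add1, add2]
  funext i
  simp only [bxor]
  generalize F A C i = x1
  generalize F A q i = x2
  generalize F A w i = x3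
  generalize F p C i = x4
  generalize F p q i = x5
  generalize F p w i = x6
  generalize F r C i = x7
  generalize F r q i = x8
  generalize F r w i = x9
  cases x1 <;> cases x2 <;> cases x3 <;> cases x4 <;> cases x5 <;> cases x6 <;> cases x7 <;> cases x8 <;>
    cases x9 <;> rfl

/-! ### The key identity and the three-matching identity -/

section main

variable {π σ : (Fin m → Bool) → Fin m → Bool} {B Bt : (Fin m → Bool) → (Fin m → Bool) → Fin m → Bool}

/-- Eight-variable Boolean bookkeeping for `key_identity` (two hypotheses, one conclusion, coordinatewise). [folklore] -/
theorem bool_key (z u v s0 sg sw tab twg : Bool)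
    (h2 : ((z ^^ (z ^^ u)) ^^ ((z ^^ v) ^^ sw)) = tab)
    (h4 : ((s0 ^^ ((z ^^ u) ^^ v)) ^^ (sg ^^ sw)) = twg) :
    twg = ((s0 ^^ sg) ^^ tab) := by
  subst h2; subst h4
  cases z <;> cases u <;> cases v <;> cases s0 <;> cases sg <;> cases sw <;> rfl

/-- Four-variable Boolean bookkeeping: `U ⊕ (A ⊕ V) = W ⊕ ((A ⊕ U) ⊕ (V ⊕ W))`. [folklore] -/
theorem bool_w3 (A U V W : Bool) : (U ^^ (A ^^ V)) = (W ^^ ((A ^^ U) ^^ (V ^^ W))) := by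
  cases A <;> cases U <;> cases V <;> cases W <;> rfl

/-- **Key identity.** If `B`, `B̃` are base-point-free brackets of `π`, `σ` and `σ ∘ π = id`, then for all `z u v`,
`B̃(π(z⊕u⊕v), B(u,v)) = σ(0) ⊕ σ(B(u,v)) ⊕ B̃(π z ⊕ π(z⊕u), π z ⊕ π(z⊕v))`: compute `σ` at
`π(z⊕u⊕v) ⊕ B(u,v) = π z ⊕ π(z⊕u) ⊕ π(z⊕v)` once by the bracket of `σ` at base point `π z` and once at base
point `0`. [cite: Carlet2020, §2.2.2] -/
theorem key_identity
    (hB : ∀ x a b, bxor (bxor (π x) (π (bxor x a))) (bxor (π (bxor x b)) (π (bxor (bxor x a) b))) = B a b)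
    (hBt : ∀ w a b, bxor (bxor (σ w) (σ (bxor w a))) (bxor (σ (bxor w b)) (σ (bxor (bxor w a) b))) = Bt a b)
    (hinv : ∀ z, σ (π z) = z) (z u v : Fin m → Bool) :
    Bt (π (bxor (bxor z u) v)) (B u v) =
      bxor (bxor (σ zeroVec) (σ (B u v))) (Bt (bxor (π z) (π (bxor z u))) (bxor (π z) (π (bxor z v)))) := by
  have h1 : bxor (bxor (π z) (π (bxor z u))) (bxor (π (bxor z v)) (π (bxor (bxor z u) v))) = B u v := hB z u v
  -- the bracket of σ at base point π z with increments π z ⊕ π (z ⊕ u), π z ⊕ π (z ⊕ v)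
  have h2 := hBt (π z) (bxor (π z) (π (bxor z u))) (bxor (π z) (π (bxor z v)))
  have ea : bxor (π z) (bxor (π z) (π (bxor z u))) = π (bxor z u) := bxor_bxor_cancel_left _ _
  have eb : bxor (π z) (bxor (π z) (π (bxor z v))) = π (bxor z v) := bxor_bxor_cancel_left _ _
  have eab : bxor (bxor (π z) (bxor (π z) (π (bxor z u)))) (bxor (π z) (π (bxor z v))) =
      bxor (π (bxor (bxor z u) v)) (B u v) := by
    rw [ea, ← h1]
    funext i
    exact bool_w3 (π z i) (π (bxor z u) i) (π (bxor z v) i) (π (bxor (bxor z u) v) i)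
  rw [eab, ea, eb, hinv, hinv, hinv] at h2
  -- the bracket of σ at base point 0 with increments π (z ⊕ u ⊕ v), B u v
  have h4 := hBt zeroVec (π (bxor (bxor z u) v)) (B u v)
  rw [zeroVec_bxor, zeroVec_bxor, hinv] at h4
  -- coordinatewise bookkeeping
  funext i
  exact bool_key (z i) (u i) (v i) (σ zeroVec i) (σ (B u v) i) (σ (bxor (π (bxor (bxor z u) v)) (B u v)) i)
    (Bt (bxor (π z) (π (bxor z u))) (bxor (π z) (π (bxor z v))) i) (Bt (π (bxor (bxor z u) v)) (B u v) i)
    (apply_eq_of_eq h2 i) (apply_eq_of_eq h4 i)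

/-- Boolean bookkeeping: xor of four copies of `key_identity`'s right-hand sides (the constants cancel). [folklore] -/
theorem bool_four (c x0 x1 x2 x3 : Bool) :
    (((c ^^ x0) ^^ (c ^^ x1)) ^^ ((c ^^ x2) ^^ (c ^^ x3))) = ((x0 ^^ x1) ^^ (x2 ^^ x3)) := by
  cases c <;> cases x0 <;> cases x1 <;> cases x2 <;> cases x3 <;> rfl

/-- **THREE-MATCHING IDENTITY (abstract brackets).** If `π, σ : 𝔽₂^m → 𝔽₂^m` have base-point-free brackets `B`, `B̃`
(i.e. are coordinatewise quadratic) and `σ ∘ π = id`, then for all `s t u v`,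
`B̃(B(s,t), B(u,v)) = B̃(B(s,u), B(t,v)) ⊕ B̃(B(t,u), B(s,v))`. [cite: Carlet2020, §2.2.2] -/
theorem threeMatching_of_brackets
    (hB : ∀ x a b, bxor (bxor (π x) (π (bxor x a))) (bxor (π (bxor x b)) (π (bxor (bxor x a) b))) = B a b)
    (hBt : ∀ w a b, bxor (bxor (σ w) (σ (bxor w a))) (bxor (σ (bxor w b)) (σ (bxor (bxor w a) b))) = Bt a b)
    (hinv : ∀ z, σ (π z) = z) (s t u v : Fin m → Bool) :
    Bt (B s t) (B u v) = bxor (Bt (B s u) (B t v)) (Bt (B t u) (B s v)) := by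
  -- biadditivity of both brackets
  have addB1 := bracket_add_left hB
  have addT1 := bracket_add_left hBt
  have addT2 := bracket_add_right hBt
  -- the key identity, with first arguments rewritten via `bracket_expand`
  have K := key_identity hB hBt hinv
  have harg : ∀ z x : Fin m → Bool, bxor (π z) (π (bxor z x)) = bxor (B z x) (bxor (π zeroVec) (π x)) := by
    intro z x
    rw [bracket_expand hB z x]
    funext i
    show (π z i ^^ ((π zeroVec i ^^ π z i) ^^ (π x i ^^ B z x i))) = (B z x i ^^ (π zeroVec i ^^ π x i))
    cases π z i <;> cases π zeroVec i <;> cases π x i <;> cases B z x i <;> rfl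
  have K' : ∀ z, Bt (π (bxor (bxor z u) v)) (B u v) = bxor (bxor (σ zeroVec) (σ (B u v)))
      (Bt (bxor (B z u) (bxor (π zeroVec) (π u))) (bxor (B z v) (bxor (π zeroVec) (π v)))) := by
    intro z; rw [K z u v, harg z u, harg z v]
  have K0 := K' zeroVec
  have K1 := K' s
  have K2 := K' t
  have K3 := K' (bxor s t)
  -- left-hand sides: the bracket of π at base point (0 ⊕ u) ⊕ v along s, t
  have hL := hB (bxor (bxor zeroVec u) v) s t
  have e1 : bxor (bxor (bxor zeroVec u) v) s = bxor (bxor s u) v := by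
    rw [zeroVec_bxor, bxor_comm (bxor u v) s]
    funext i; exact (Bool.xor_assoc _ _ _).symm
  have e2 : bxor (bxor (bxor zeroVec u) v) t = bxor (bxor t u) v := by
    rw [zeroVec_bxor, bxor_comm (bxor u v) t]
    funext i; exact (Bool.xor_assoc _ _ _).symm
  have e3 : bxor (bxor (bxor (bxor zeroVec u) v) s) t = bxor (bxor (bxor s t) u) v := by
    rw [e1, bxor_right_comm (bxor s u) v t, bxor_right_comm s u t]
  rw [e3, e1, e2] at hL
  -- sum of the four left-hand sides = Bt (B s t) (B u v)
  have sumL : bxor (bxor (Bt (π (bxor (bxor zeroVec u) v)) (B u v)) (Bt (π (bxor (bxor s u) v)) (B u v)))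
      (bxor (Bt (π (bxor (bxor t u) v)) (B u v)) (Bt (π (bxor (bxor (bxor s t) u) v)) (B u v))) =
      Bt (B s t) (B u v) := by
    rw [← addT1, ← addT1, ← addT1, hL]
  have B0u : B zeroVec u = zeroVec := bracket_zero_left hB u
  have B0v : B zeroVec v = zeroVec := bracket_zero_left hB v
  -- put everything together
  rw [← sumL, K0, K1, K2, K3, addB1 s t u, addB1 s t v, B0u, B0v, zeroVec_bxor, zeroVec_bxor]
  have grid := second_diff Bt addT1 addT2 (bxor (π zeroVec) (π u)) (bxor (π zeroVec) (π v))
    (B s u) (B s v) (B t u) (B t v)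
  rw [← grid]
  -- align the argument shapes with the grid lemma
  rw [bxor_comm (B s u) (bxor (π zeroVec) (π u)), bxor_comm (B s v) (bxor (π zeroVec) (π v)),
    bxor_comm (B t u) (bxor (π zeroVec) (π u)), bxor_comm (B t v) (bxor (π zeroVec) (π v)),
    bxor_comm (bxor (B s u) (B t u)) (bxor (π zeroVec) (π u)),
    bxor_comm (bxor (B s v) (B t v)) (bxor (π zeroVec) (π v))]
  have hA1 : bxor (bxor (π zeroVec) (π u)) (bxor (B s u) (B t u)) =
      bxor (bxor (bxor (π zeroVec) (π u)) (B s u)) (B t u) := by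
    funext i; exact (Bool.xor_assoc _ _ _).symm
  have hA2 : bxor (bxor (π zeroVec) (π v)) (bxor (B s v) (B t v)) =
      bxor (bxor (bxor (π zeroVec) (π v)) (B s v)) (B t v) := by
    funext i; exact (Bool.xor_assoc _ _ _).symm
  rw [hA1, hA2]
  funext i
  exact bool_four (σ zeroVec i ^^ σ (B u v) i) _ _ _ _

/-- **THREE-MATCHING IDENTITY for a biquadratic pair.** Let `π σ : 𝔽₂^m → 𝔽₂^m` be coordinatewise of degree `≤ 2`
(`IsDegLeFun 2`) with `σ (π z) = z` for all `z`, and let `B(a,b) = π(a⊕b) ⊕ π(a) ⊕ π(b) ⊕ π(0)`,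
`B̃(a,b) = σ(a⊕b) ⊕ σ(a) ⊕ σ(b) ⊕ σ(0)` be their polar vectors. Then for all `s t u v`,
`B̃(B(s,t), B(u,v)) = B̃(B(s,u), B(t,v)) ⊕ B̃(B(t,u), B(s,v))`. [cite: Carlet2020, §2.2.2 and §5.2] -/
theorem threeMatching
    (hπ : ∀ i, IsDegLeFun 2 fun y => π y i) (hσ : ∀ i, IsDegLeFun 2 fun w => σ w i)
    (hinv : ∀ z, σ (π z) = z) (s t u v : Fin m → Bool) :
    (fun i => (σ (bxor (fun j => (π (bxor s t) j ^^ π s j ^^ π t j ^^ π zeroVec j))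
                        (fun j => (π (bxor u v) j ^^ π u j ^^ π v j ^^ π zeroVec j))) i ^^
               σ (fun j => (π (bxor s t) j ^^ π s j ^^ π t j ^^ π zeroVec j)) i ^^
               σ (fun j => (π (bxor u v) j ^^ π u j ^^ π v j ^^ π zeroVec j)) i ^^ σ zeroVec i)) =
      bxor
        (fun i => (σ (bxor (fun j => (π (bxor s u) j ^^ π s j ^^ π u j ^^ π zeroVec j))
                             (fun j => (π (bxor t v) j ^^ π t j ^^ π v j ^^ π zeroVec j))) i ^^
                   σ (fun j => (π (bxor s u) j ^^ π s j ^^ π u j ^^ π zeroVec j)) i ^^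
                   σ (fun j => (π (bxor t v) j ^^ π t j ^^ π v j ^^ π zeroVec j)) i ^^ σ zeroVec i))
        (fun i => (σ (bxor (fun j => (π (bxor t u) j ^^ π t j ^^ π u j ^^ π zeroVec j))
                             (fun j => (π (bxor s v) j ^^ π s j ^^ π v j ^^ π zeroVec j))) i ^^
                   σ (fun j => (π (bxor t u) j ^^ π t j ^^ π u j ^^ π zeroVec j)) i ^^
                   σ (fun j => (π (bxor s v) j ^^ π s j ^^ π v j ^^ π zeroVec j)) i ^^ σ zeroVec i)) := by
  have hB : ∀ x a b, bxor (bxor (π x) (π (bxor x a))) (bxor (π (bxor x b)) (π (bxor (bxor x a) b))) =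
      (fun (a b : Fin m → Bool) (j : Fin m) => (π (bxor a b) j ^^ π a j ^^ π b j ^^ π zeroVec j)) a b := by
    intro x a b
    funext j
    have h := Summit.QuantumAdvantage.QuantumAdvantage.Theorems.SignedExactCubicForrelationNotPrBPP.PolarGeometry.quad_bracket
      (hπ j) x a b
    show ((π x j ^^ π (bxor x a) j) ^^ (π (bxor x b) j ^^ π (bxor (bxor x a) b) j)) =
      (π (bxor a b) j ^^ π a j ^^ π b j ^^ π zeroVec j)
    rw [bxor_right_comm x a b]
    exact h
  have hBt : ∀ w a b, bxor (bxor (σ w) (σ (bxor w a))) (bxor (σ (bxor w b)) (σ (bxor (bxor w a) b))) =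
      (fun (a b : Fin m → Bool) (j : Fin m) => (σ (bxor a b) j ^^ σ a j ^^ σ b j ^^ σ zeroVec j)) a b := by
    intro w a b
    funext j
    have h := Summit.QuantumAdvantage.QuantumAdvantage.Theorems.SignedExactCubicForrelationNotPrBPP.PolarGeometry.quad_bracket
      (hσ j) w a b
    show ((σ w j ^^ σ (bxor w a) j) ^^ (σ (bxor w b) j ^^ σ (bxor (bxor w a) b) j)) =
      (σ (bxor a b) j ^^ σ a j ^^ σ b j ^^ σ zeroVec j)
    rw [bxor_right_comm w a b]
    exact h
  exact threeMatching_of_brackets hB hBt hinv s t u v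

end main

end ThreeMatching

/-- **Registered stub `stub_threeMatching`** (item stmt-QuantumAdvantage-14671): the three-matching identity for a
biquadratic pair, in closed form (all names fully qualified; `ThreeMatching.threeMatching`). [cite: Carlet2020, §2.2.2] -/
theorem stub_threeMatching : ∀ (m : ℕ) (π σ : (Fin m → Bool) → Fin m → Bool), (∀ i, Literature.Computability.QuantumComplexity.IsDegLeFun 2 fun y => π y i) → (∀ i, Literature.Computability.QuantumComplexity.IsDegLeFun 2 fun w => σ w i) → (∀ z, σ (π z) = z) → ∀ s t u v : Fin m → Bool, (fun i => (σ (Literature.Computability.QuantumComplexity.BuzetChailloux.bxor (fun j => (π (Literature.Computability.QuantumComplexity.BuzetChailloux.bxor s t) j ^^ π s j ^^ π t j ^^ π Literature.Computability.QuantumComplexity.BuzetChailloux.zeroVec j)) (fun j => (π (Literature.Computability.QuantumComplexity.BuzetChailloux.bxor u v) j ^^ π u j ^^ π v j ^^ π Literature.Computability.QuantumComplexity.BuzetChailloux.zeroVec j))) i ^^ σ (fun j => (π (Literature.Computability.QuantumComplexity.BuzetChailloux.bxor s t) j ^^ π s j ^^ π t j ^^ π Literature.Computability.QuantumComplexity.BuzetChailloux.zeroVec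 j)) i ^^ σ (fun j => (π (Literature.Computability.QuantumComplexity.BuzetChailloux.bxor u v) j ^^ π u j ^^ π v j ^^ π Literature.Computability.QuantumComplexity.BuzetChailloux.zeroVec j)) i ^^ σ Literature.Computability.QuantumComplexity.BuzetChailloux.zeroVec i)) = Literature.Computability.QuantumComplexity.BuzetChailloux.bxor (fun i => (σ (Literature.Computability.QuantumComplexity.BuzetChailloux.bxor (fun j => (π (Literature.Computability.QuantumComplexity.BuzetChailloux.bxor s u) j ^^ π s j ^^ π u j ^^ π Literature.Computability.QuantumComplexity.BuzetChailloux.zeroVec j)) (fun j => (π (Literature.Computability.QuantumComplexity.BuzetChailloux.bxor t v) j ^^ π t j ^^ π v j ^^ π Literature.Computability.QuantumComplexity.BuzetChailloux.zeroVec j))) i ^^ σ (fun j => (π (Literature.Computability.QuantumComplexity.BuzetChailloux.bxor s u) j ^^ π s j ^^ π u j ^^ π Literature.Computability.QuantumComplexity.BuzetChailloux.zeroVec j)) i ^^ σ (fun j => (π (Literature.Computability.QuantumComplexity.BuzetChailloux.bxor t v) j ^^ π t j ^^ π v j ^^ π Literature.Computability.QuantumComplexity.BuzetChailloux.zeroVec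 j)) i ^^ σ Literature.Computability.QuantumComplexity.BuzetChailloux.zeroVec i)) (fun i => (σ (Literature.Computability.QuantumComplexity.BuzetChailloux.bxor (fun j => (π (Literature.Computability.QuantumComplexity.BuzetChailloux.bxor t u) j ^^ π t j ^^ π u j ^^ π Literature.Computability.QuantumComplexity.BuzetChailloux.zeroVec j)) (fun j => (π (Literature.Computability.QuantumComplexity.BuzetChailloux.bxor s v) j ^^ π s j ^^ π v j ^^ π Literature.Computability.QuantumComplexity.BuzetChailloux.zeroVec j))) i ^^ σ (fun j => (π (Literature.Computability.QuantumComplexity.BuzetChailloux.bxor t u) j ^^ π t j ^^ π u j ^^ π Literature.Computability.QuantumComplexity.BuzetChailloux.zeroVec j)) i ^^ σ (fun j => (π (Literature.Computability.QuantumComplexity.BuzetChailloux.bxor s v) j ^^ π s j ^^ π v j ^^ π Literature.Computability.QuantumComplexity.BuzetChailloux.zeroVec j)) i ^^ σ Literature.Computability.QuantumComplexity.BuzetChailloux.zeroVec i)) :=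
  fun _m _π _σ hπ hσ hinv s t u v => ThreeMatching.threeMatching hπ hσ hinv s t u v

end Summit.QuantumAdvantage.QuantumAdvantage.Theorems.SignedExactCubicForrelationInPrBPP

end
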